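import Mathlib
import Literature.NumberTheory.Transcendental.KZIdealTetrahedron
import Literature.Geometry.Riemannian.TwistorFrameChange

/-!
# `OffTetraSectorKernel` (stmt-KontsevichZagierPeriods-10557) — line `odd-hyperbolic-ladder` (skeleton v3),
stub `stub_coneAbsorptionTwo`: auxiliary computations in the paraboloid lift

Lead c2. The cone absorption (Dupont–Sah's lune argument inside the Kontsevich–Zagier calculus) uses two
isometries of the upper half space through their action on the paraboloid lift `Ql p = (|p|², p₀, p₁, 1)`:
the normalising boundary similarity `p ↦ ((p₀ − q₀)/q₂, (p₁ − q₁)/q₂, p₂/q₂)` (Lorentz matrix `Mh q`, factor `1`,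
sending the lift of the apex `q` to `(1,0,0,1)`) and the point reflection through `(0,0,1)`,
`p ↦ (−p₀, −p₁, p₂)/|p|²` (Lorentz matrix `M₀ (n,x,y,m) = (m,−x,−y,n)`, factor `1/|p|²`). This file records these
matrix identities (determinants by the tree's `Matrix.det_fin_four`), the preservation of NULL future rows (`x² + y² = n m`, `m ≥ 0`, `n + m > 0`: lifts of ideal
points) and algebraicity. No definitions: the matrices enter as variables pinned by equations.

References: J. L. Dupont, C.-H. Sah, *Scissors congruences II*, J. Pure Appl. Algebra 25 (1982), §3.
-/

noncomputable section

open Set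

namespace Summit.KontsevichZagierPeriods.HyperbolicBloch.OffTetraSectorKernel

/-- Rows mapped by a matrix: determinant. [folklore] -/
theorem coneAux_det_of_mulVec_rows (M : Matrix (Fin 4) (Fin 4) ℝ) (v : Fin 4 → Fin 4 → ℝ) :
    (Matrix.of fun i => M.mulVec (v i)).det = (Matrix.of v).det * M.det := by
  have e : (Matrix.of fun i => M.mulVec (v i)) = Matrix.of v * M.transpose := by
    ext i j
    simp [Matrix.mul_apply, Matrix.mulVec, dotProduct, Matrix.transpose_apply, mul_comm]
  rw [e, Matrix.det_mul, Matrix.det_transpose]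

/-! ### The antipodal Lorentz matrix `M₀ (n, x, y, m) = (m, −x, −y, n)` -/

/-- Action of `M₀`. [folklore] -/
theorem coneAux_M₀_mulVec (M₀ : Matrix (Fin 4) (Fin 4) ℝ)
    (hM₀ : M₀ = !![0, 0, 0, 1; 0, -1, 0, 0; 0, 0, -1, 0; 1, 0, 0, 0]) (x : Fin 4 → ℝ) :
    M₀.mulVec x = ![x 3, -x 1, -x 2, x 0] := by
  subst hM₀
  ext i
  fin_cases i <;> simp [Matrix.mulVec, dotProduct, Fin.sum_univ_four]

/-- `det M₀ = −1`. [folklore] -/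
theorem coneAux_det_M₀ (M₀ : Matrix (Fin 4) (Fin 4) ℝ)
    (hM₀ : M₀ = !![0, 0, 0, 1; 0, -1, 0, 0; 0, 0, -1, 0; 1, 0, 0, 0]) : M₀.det = -1 := by
  subst hM₀; rw [Matrix.det_fin_four]; simp

/-- `M₀` fixes the apex row `(1, 0, 0, 1)`. [folklore] -/
theorem coneAux_M₀_mulVec_apex (M₀ : Matrix (Fin 4) (Fin 4) ℝ)
    (hM₀ : M₀ = !![0, 0, 0, 1; 0, -1, 0, 0; 0, 0, -1, 0; 1, 0, 0, 0]) :
    M₀.mulVec ![1, 0, 0, 1] = ![1, 0, 0, 1] := by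
  rw [coneAux_M₀_mulVec M₀ hM₀]; ext i; fin_cases i <;> simp

/-- The point reflection through `(0,0,1)`, `p ↦ (−p₀, −p₁, p₂)/|p|²`, acts on lifts through `M₀` with the
positive factor `1/|p|²`. [folklore] -/
theorem coneAux_lift_antipode :
    ∀ (Ql : (Fin 3 → ℝ) → Fin 4 → ℝ), (∀ p, Ql p = ![p 0 ^ 2 + p 1 ^ 2 + p 2 ^ 2, p 0, p 1, 1]) →
    ∀ (M₀ : Matrix (Fin 4) (Fin 4) ℝ), M₀ = !![0, 0, 0, 1; 0, -1, 0, 0; 0, 0, -1, 0; 1, 0, 0, 0] →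
    ∀ (p : Fin 3 → ℝ), 0 < p 2 →
      Ql ![-p 0 / (p 0 ^ 2 + p 1 ^ 2 + p 2 ^ 2), -p 1 / (p 0 ^ 2 + p 1 ^ 2 + p 2 ^ 2),
        p 2 / (p 0 ^ 2 + p 1 ^ 2 + p 2 ^ 2)] = (p 0 ^ 2 + p 1 ^ 2 + p 2 ^ 2)⁻¹ • M₀.mulVec (Ql p) := by
  intro Ql hQl M₀ hM₀ p hp
  rw [coneAux_M₀_mulVec M₀ hM₀, hQl, hQl]
  have hN : p 0 ^ 2 + p 1 ^ 2 + p 2 ^ 2 ≠ 0 := by positivity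
  ext i
  fin_cases i
  · simp
    field_simp
  · simp [div_eq_inv_mul]
  · simp [div_eq_inv_mul]
  · simp [inv_mul_cancel₀ hN]

/-- `M₀` preserves null future rows. [folklore] -/
theorem coneAux_null_M₀ (M₀ : Matrix (Fin 4) (Fin 4) ℝ)
    (hM₀ : M₀ = !![0, 0, 0, 1; 0, -1, 0, 0; 0, 0, -1, 0; 1, 0, 0, 0]) {x : Fin 4 → ℝ}
    (hx : x 1 ^ 2 + x 2 ^ 2 = x 0 * x 3 ∧ 0 ≤ x 3 ∧ 0 < x 0 + x 3) :
    (M₀.mulVec x) 1 ^ 2 + (M₀.mulVec x) 2 ^ 2 = (M₀.mulVec x) 0 * (M₀.mulVec x) 3 ∧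
      0 ≤ (M₀.mulVec x) 3 ∧ 0 < (M₀.mulVec x) 0 + (M₀.mulVec x) 3 := by
  obtain ⟨h1, h2, h3⟩ := hx
  rw [coneAux_M₀_mulVec M₀ hM₀]
  refine ⟨?_, ?_, ?_⟩
  · simp; linarith [h1]
  · simp only [Matrix.cons_val]
    by_cases h : x 3 = 0
    · have : x 1 ^ 2 + x 2 ^ 2 = 0 := by rw [h1, h, mul_zero]
      nlinarith [sq_nonneg (x 1), sq_nonneg (x 2)]
    · have h3' : 0 < x 3 := lt_of_le_of_ne h2 (Ne.symm h)
      nlinarith [sq_nonneg (x 1), sq_nonneg (x 2)]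
  · simp; linarith

/-! ### The normalising similarity and its Lorentz matrix `Mh q` -/

/-- Action of `Mh q`. [folklore] -/
theorem coneAux_Mh_mulVec (q : Fin 3 → ℝ) (Mh : Matrix (Fin 4) (Fin 4) ℝ)
    (hMh : Mh = !![1 / q 2 ^ 2, -2 * q 0 / q 2 ^ 2, -2 * q 1 / q 2 ^ 2, (q 0 ^ 2 + q 1 ^ 2) / q 2 ^ 2;
      0, 1 / q 2, 0, -q 0 / q 2; 0, 0, 1 / q 2, -q 1 / q 2; 0, 0, 0, 1]) (x : Fin 4 → ℝ) :
    Mh.mulVec x = ![(x 0 - 2 * q 0 * x 1 - 2 * q 1 * x 2 + (q 0 ^ 2 + q 1 ^ 2) * x 3) / q 2 ^ 2,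
      (x 1 - q 0 * x 3) / q 2, (x 2 - q 1 * x 3) / q 2, x 3] := by
  subst hMh
  ext i
  fin_cases i <;> simp [Matrix.mulVec, dotProduct, Fin.sum_univ_four] <;> ring

/-- `det (Mh q) = q₂⁻⁴`. [folklore] -/
theorem coneAux_det_Mh (q : Fin 3 → ℝ) (hq : 0 < q 2) (Mh : Matrix (Fin 4) (Fin 4) ℝ)
    (hMh : Mh = !![1 / q 2 ^ 2, -2 * q 0 / q 2 ^ 2, -2 * q 1 / q 2 ^ 2, (q 0 ^ 2 + q 1 ^ 2) / q 2 ^ 2;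
      0, 1 / q 2, 0, -q 0 / q 2; 0, 0, 1 / q 2, -q 1 / q 2; 0, 0, 0, 1]) : Mh.det = 1 / q 2 ^ 4 := by
  subst hMh; rw [Matrix.det_fin_four]; simp
  field_simp

/-- The normalising similarity in the shape of `IsometryMove.simil_transport` (`α = q₂⁻¹`,
`β = −(q₀ + i q₁) q₂⁻¹`, `η = 1`) is `p ↦ ((p₀ − q₀)/q₂, (p₁ − q₁)/q₂, p₂/q₂)`. [folklore] -/
theorem coneAux_simil_normalise_apply (q : Fin 3 → ℝ) (hq : 0 < q 2) (S : (Fin 3 → ℝ) → (Fin 3 → ℝ))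
    (hS : ∀ p, S p = ![(((q 2 : ℂ)⁻¹) * (Complex.mk (p 0) (1 * p 1)) + (-(Complex.mk (q 0) (q 1)) * (q 2 : ℂ)⁻¹)).re,
      (((q 2 : ℂ)⁻¹) * (Complex.mk (p 0) (1 * p 1)) + (-(Complex.mk (q 0) (q 1)) * (q 2 : ℂ)⁻¹)).im,
      ‖((q 2 : ℂ)⁻¹)‖ * p 2]) (p : Fin 3 → ℝ) :
    S p = ![(p 0 - q 0) / q 2, (p 1 - q 1) / q 2, p 2 / q 2] := by
  rw [hS]
  have hq0 : (q 2 : ℂ) ≠ 0 := by exact_mod_cast hq.ne'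
  have hn : ‖((q 2 : ℂ)⁻¹)‖ = (q 2)⁻¹ := by
    rw [norm_inv, Complex.norm_real, Real.norm_eq_abs, abs_of_pos hq]
  ext i
  fin_cases i
  · simp [Complex.inv_re, Complex.inv_im, Complex.normSq_apply]
    field_simp
    ring
  · simp [Complex.inv_re, Complex.inv_im, Complex.normSq_apply]
    field_simp
    ring
  · simp [hn, div_eq_inv_mul]

/-- The similarity acts on lifts through `Mh q` (factor `1`). [folklore] -/
theorem coneAux_lift_simil (Ql : (Fin 3 → ℝ) → Fin 4 → ℝ)
    (hQl : ∀ p, Ql p = ![p 0 ^ 2 + p 1 ^ 2 + p 2 ^ 2, p 0, p 1, 1]) (q : Fin 3 → ℝ) (hq : 0 < q 2)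
    (Mh : Matrix (Fin 4) (Fin 4) ℝ)
    (hMh : Mh = !![1 / q 2 ^ 2, -2 * q 0 / q 2 ^ 2, -2 * q 1 / q 2 ^ 2, (q 0 ^ 2 + q 1 ^ 2) / q 2 ^ 2;
      0, 1 / q 2, 0, -q 0 / q 2; 0, 0, 1 / q 2, -q 1 / q 2; 0, 0, 0, 1]) (p : Fin 3 → ℝ) :
    Ql ![(p 0 - q 0) / q 2, (p 1 - q 1) / q 2, p 2 / q 2] = Mh.mulVec (Ql p) := by
  rw [coneAux_Mh_mulVec q Mh hMh, hQl, hQl]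
  have hq0 : q 2 ≠ 0 := hq.ne'
  ext i
  fin_cases i
  · simp
    field_simp
    ring
  · simp
  · simp
  · simp

/-- `Mh q` sends the lift of the apex `q` to `(1, 0, 0, 1)`. [folklore] -/
theorem coneAux_Mh_mulVec_apex (Ql : (Fin 3 → ℝ) → Fin 4 → ℝ)
    (hQl : ∀ p, Ql p = ![p 0 ^ 2 + p 1 ^ 2 + p 2 ^ 2, p 0, p 1, 1]) (q : Fin 3 → ℝ) (hq : 0 < q 2)
    (Mh : Matrix (Fin 4) (Fin 4) ℝ)
    (hMh : Mh = !![1 / q 2 ^ 2, -2 * q 0 / q 2 ^ 2, -2 * q 1 / q 2 ^ 2, (q 0 ^ 2 + q 1 ^ 2) / q 2 ^ 2;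
      0, 1 / q 2, 0, -q 0 / q 2; 0, 0, 1 / q 2, -q 1 / q 2; 0, 0, 0, 1]) :
    Mh.mulVec (Ql q) = ![1, 0, 0, 1] := by
  rw [coneAux_Mh_mulVec q Mh hMh, hQl]
  have hq0 : q 2 ≠ 0 := hq.ne'
  ext i
  fin_cases i
  · simp
    field_simp
    ring
  · simp
  · simp
  · simp

/-- `Mh q` preserves null future rows. [folklore] -/
theorem coneAux_null_Mh (q : Fin 3 → ℝ) (hq : 0 < q 2) (Mh : Matrix (Fin 4) (Fin 4) ℝ)
    (hMh : Mh = !![1 / q 2 ^ 2, -2 * q 0 / q 2 ^ 2, -2 * q 1 / q 2 ^ 2, (q 0 ^ 2 + q 1 ^ 2) / q 2 ^ 2;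
      0, 1 / q 2, 0, -q 0 / q 2; 0, 0, 1 / q 2, -q 1 / q 2; 0, 0, 0, 1]) {x : Fin 4 → ℝ}
    (hx : x 1 ^ 2 + x 2 ^ 2 = x 0 * x 3 ∧ 0 ≤ x 3 ∧ 0 < x 0 + x 3) :
    (Mh.mulVec x) 1 ^ 2 + (Mh.mulVec x) 2 ^ 2 = (Mh.mulVec x) 0 * (Mh.mulVec x) 3 ∧
      0 ≤ (Mh.mulVec x) 3 ∧ 0 < (Mh.mulVec x) 0 + (Mh.mulVec x) 3 := by
  obtain ⟨h1, h2, h3⟩ := hx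
  rw [coneAux_Mh_mulVec q Mh hMh]
  have hq0 : q 2 ≠ 0 := hq.ne'
  refine ⟨?_, ?_, ?_⟩
  · have h1' : x 3 * (x 1 ^ 2 + x 2 ^ 2) = x 3 * (x 0 * x 3) := by rw [h1]
    simp
    field_simp
    nlinarith [h1, h1']
  · simpa using h2
  · simp only [Matrix.cons_val]
    by_cases h : x 3 = 0
    · have h0 : x 1 ^ 2 + x 2 ^ 2 = 0 := by rw [h1, h, mul_zero]
      have hx1 : x 1 = 0 := by nlinarith [sq_nonneg (x 1), sq_nonneg (x 2)]
      have hx2 : x 2 = 0 := by nlinarith [sq_nonneg (x 1), sq_nonneg (x 2)]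
      rw [h, hx1, hx2]
      simp
      have : 0 < x 0 := by linarith
      positivity
    · have h3' : 0 < x 3 := lt_of_le_of_ne h2 (Ne.symm h)
      have hnn : 0 ≤ x 0 - 2 * q 0 * x 1 - 2 * q 1 * x 2 + (q 0 ^ 2 + q 1 ^ 2) * x 3 := by
        by_contra hneg
        push Not at hneg
        have : (x 0 - 2 * q 0 * x 1 - 2 * q 1 * x 2 + (q 0 ^ 2 + q 1 ^ 2) * x 3) * x 3 < 0 :=
          mul_neg_of_neg_of_pos hneg h3'
        nlinarith [sq_nonneg (x 1 - q 0 * x 3), sq_nonneg (x 2 - q 1 * x 3)]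
      positivity

/-- Entries of `Mh q x` are algebraic when `q`, `x` are. [folklore] -/
theorem coneAux_isAlgebraic_Mh_mulVec (q : Fin 3 → ℝ) (hq : ∀ i, IsAlgebraic ℚ (q i))
    (Mh : Matrix (Fin 4) (Fin 4) ℝ)
    (hMh : Mh = !![1 / q 2 ^ 2, -2 * q 0 / q 2 ^ 2, -2 * q 1 / q 2 ^ 2, (q 0 ^ 2 + q 1 ^ 2) / q 2 ^ 2;
      0, 1 / q 2, 0, -q 0 / q 2; 0, 0, 1 / q 2, -q 1 / q 2; 0, 0, 0, 1]) {x : Fin 4 → ℝ}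
    (hx : ∀ k, IsAlgebraic ℚ (x k)) (k : Fin 4) : IsAlgebraic ℚ ((Mh.mulVec x) k) := by
  rw [coneAux_Mh_mulVec q Mh hMh]
  have h2 : IsAlgebraic ℚ (2 : ℝ) := by simpa using isAlgebraic_algebraMap (R := ℚ) (A := ℝ) (2 : ℚ)
  fin_cases k
  · simp only [Fin.zero_eta, Matrix.cons_val_zero, div_eq_mul_inv]
    exact (((hx 0).sub ((h2.mul (hq 0)).mul (hx 1))).sub ((h2.mul (hq 1)).mul (hx 2))
      |>.add ((((hq 0).pow 2).add ((hq 1).pow 2)).mul (hx 3))).mul ((hq 2).pow 2).inv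
  · simp only [Fin.mk_one, Matrix.cons_val_one, div_eq_mul_inv]
    exact ((hx 1).sub ((hq 0).mul (hx 3))).mul (hq 2).inv
  · simp only [Fin.reduceFinMk, Matrix.cons_val_two, Matrix.tail_cons, Matrix.head_cons, div_eq_mul_inv]
    exact ((hx 2).sub ((hq 1).mul (hx 3))).mul (hq 2).inv
  · simpa using hx 3

/-- Components of the lift of an algebraic point are algebraic. [folklore] -/
theorem coneAux_isAlgebraic_lift (Ql : (Fin 3 → ℝ) → Fin 4 → ℝ)
    (hQl : ∀ p, Ql p = ![p 0 ^ 2 + p 1 ^ 2 + p 2 ^ 2, p 0, p 1, 1]) (q : Fin 3 → ℝ)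
    (hq : ∀ i, IsAlgebraic ℚ (q i)) (k : Fin 4) : IsAlgebraic ℚ (Ql q k) := by
  rw [hQl]
  fin_cases k
  · simpa using (((hq 0).pow 2).add ((hq 1).pow 2)).add ((hq 2).pow 2)
  · simpa using hq 0
  · simpa using hq 1
  · simpa using isAlgebraic_one

end Summit.KontsevichZagierPeriods.HyperbolicBloch.OffTetraSectorKernel

end
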